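import Summits.BirchSwinnertonDyer.Rank1Residual.Additive.KatoDescentDatum
import Summits.BirchSwinnertonDyer.Rank1Residual.O6.O6Targets
import Summits.BirchSwinnertonDyer.Rank1Residual.O5.O5Targets
import HarnessLib

/-!
# The DESCENT `KMC_p(f_E)⁰ ⇒ BSD_p` in analytic rank `0` at an ADDITIVE, POTENTIALLY GOOD prime `p ≠ 2`
# under (12.5.2) — and its converse `BSD_p ⇒ KMC_p⁰` — with the descent algebra PROVED (tree theorem
# `Kato2004.index_zeta_eq_natCard_coinvariants_of_conj_12_10`) and every remaining input a NAMED reading;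
# T-O6-A (A0) `O6.LowerHalfRankZeroOfKMC` and the O5 ∪ O6 shell follow (cell `bsd-potss`, seat `kmc`)

HONEST FRAMING (cell `bsd-potss`, `run/shared/lean/pub/bsd-potss/`, FULL-BSD rank-`≤ 1` programme
tranche 1b, row B4/B5 = O5/O6, construction K9 "descent KMC ⇒ BSD_p at an additive potentially
supersingular prime"; typed against the class shells of cell `b2b-bsdres`, lane CLASS-CLOSURE,
`Additive/PotSupersingularTargets.lean`, `O5/O5Targets.lean`, `O6/O6Targets.lean`,
`O6/MainConjectureEvenIffBSD.lean`): NOTHING about Kato's Main Conjecture is asserted. `KMC⁰(W,p)` —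
Kato, Astérisque 295, Conj. 12.10 (p. 224) for `T = T_pW` on the `Δ`-TRIVIAL component of
`Λ = ℤ_p⟦Gal(ℚ(ζ_{p^∞})/ℚ)⟧ = ⊕_{Δ̂} ℤ_p⟦Γ⟧` — enters ONLY as an interface (section variable `KMC`,
read through a Kato descent datum, schema `ReadsTrivialKMC`), exactly as in the O5/O6 shells; Kato's
objects `𝐇¹(T)`, `z_γ^{(p)}`, `𝐇²(T)`, `H^q(ℤ[1/p], j_*T)` are not tree objects and enter as the
INTERFACE `KatoDescentDatum` + `IsKatoDescentDatumOf` (definition request D-O6-2 / D-O5-GV-1 style);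
the printed theorems about them enter as three hypothesis SCHEMATA with locators (§2). Census
numbers are not inputs of anything; nothing is booked; no mark of `RESIDUAL-MAP.md` moves.

## What this file does (part 2; part 1 = `Additive/KatoDescentDatum.lean`: the INTERFACE
`KatoDescentDatum p` with `D.Conj1210` / `D.Divisibility` / `D.zetaIndex` / `D.h2Card`, the two descents
on the datum from the tree theorem `Kato2004.index_zeta_eq_natCard_coinvariants_of_conj_12_10` and its
converse, the three READINGS `DescentCountReading` / `DivisibilityReading` / `Realizable` and the
interface lemma `ReadsTrivialKMC`, and the rank-`0` `#Ш_an` bookkeeping)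

§4–§5 THEOREMS (kernel assemblies; the descent algebra is the tree theorem, the arithmetic is `linarith`):
* `missingPPartAt_of_kmc_of_readings` — **KMC⁰ ⇒ BSD_p** (both halves, `MissingPPartAt W p`) for
  `r_an = 0`, `p ≠ 2`, `Addv W p`, `0 ≤ ord_p j(W)`, (12.5.2);
* `conj1210_of_missingLowerBoundAt_of_readings` / `kmc_of_missingLowerBoundAt_of_readings` — **the
  converse: BSD_p (indeed its lower half) ⇒ Conj. 12.10 on the trivial component**, for every
  realised datum; so every census row closed by the Tamagawa-exact fact (`p ∤ #Ш_an`) or by a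
  descent certificate PROVES `KMC⁰` for that curve;
* `kmc_iff_missingLowerBoundAt_of_readings` — PROPOSITION M of `O6/MainConjectureEvenIffBSD.lean`
  at EVERY additive potentially good `p ≠ 2`, with its hypotheses (C3) `3 ∤ c_ℓ` and (H3)
  `W(ℚ₃)[3] = 0` REMOVED and its descent identities `hm`/`hζ` PROVED;
* `lowerHalfRankZeroOfKMC_of_readings` — **T-O6-A (A0) `O6.LowerHalfRankZeroOfKMC KMC`**, and
  `potSupersingularLowerHalfRankZeroOfKMC_of_readings` — the shared O5 ∪ O6 shell
  `O5.PotSupersingularLowerHalfRankZeroOfKMC KMC`, and `potGoodLowerHalfRankZero_of_kmc_of_readings` —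
  the uniform shell `PotGoodLowerHalfRankZero` GRANTED `KMC⁰` on its rows with (12.5.2): all from the
  readings, i.e. the O5/O6 rank-`0` big-image lower half is REDUCED to `KMC⁰` + three printed readings.

WHAT THIS IS NOT. Not a proof of Kato's Main Conjecture for any curve class (it is the HYPOTHESIS);
not a construction of `𝐇^q(T)`/`z_Kato` in the tree (interface); nothing at `p = 2`, nothing at a
potentially MULTIPLICATIVE additive prime (Thm. 14.5 (3) / the exception (12.5.1)), nothing without
(12.5.2) (reducible `E[p]`, i.e. the X3 rows, need the `μ > 0`-tolerant isogeny transport of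
`O6.X3WildOfKMC` — not here), nothing in analytic rank `1` (the Perrin-Riou 'Kato point' formula at
an additive prime — T-O6-A (A1)'s `PRKato` — is a separate sub-conjecture; memo
`pub/bsd-potss/KMC-DESCENT-MEMO.md` §4). The three UNREVIEWED SEAMS of PROPOSITION M are now
exactly the content of the schemata: (i) the descent sequences (14.14.1)–(14.14.2) for `j_*`-cohomology
along `ℚ(ζ_{p^∞})/ℚ` and (ii) the `Δ`-component bookkeeping = `Realizable`/`ReadsTrivialKMC`;
(iii) the Néron-period normalisation at an additive `p` = inside `DescentCountReading` (audited for
A161″: Prop. 14.21/14.22, `KATO2004-TYPING.md` §14.2 row l′).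

References: K. Kato, Astérisque 295 (2004): Thm. 12.4 (p. 221), Thm. 12.5 (4) and (12.5.2)
(p. 222), Conj. 12.10 (p. 224), 13.8, Thm. 14.5 (pp. 236–237), §14.8–14.10, §14.14 (14.14.1)–(14.14.2)
and Lemma 14.15 (pp. 243–244), Prop. 14.16 (p. 244), Lemma 14.18, Prop. 14.21–14.22 (pp. 247–249)
[Kato2004Asterisque]; R. Greenberg, LNM 1716 (1999) Prop. 4.13, §3 [GreenbergLNM1716]; C.-H. Kim,
AJM 148 (2026) §3.2.3 [Kim2022StructureSelmer]; R. L. Miller, LMS JCM 14 (2011) Def. 1.1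
[Miller2011LMS]; B. Mazur, Invent. Math. 44 (1978) / Mazur 1977 III.5 (torsion under (irr)) [Mazur1977].
-/

set_option autoImplicit false

noncomputable section

open scoped Classical

open WeierstrassCurve Literature.NumberTheory.EllipticCurves
  Literature.NumberTheory.EllipticCurves.ModularForms
  Literature.NumberTheory.EllipticCurves.Rank1Residual
  Literature.NumberTheory.EllipticCurves.Rank1Residual.Typed
  Literature.NumberTheory.EllipticCurves.IwasawaAlgebra

namespace Summit.BirchSwinnertonDyer.Rank1Residual.Additive

/-! ## §4 THE DESCENT AND ITS CONVERSE over the readings (kernel assemblies; nothing asserted) -/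

section Descent

variable {IsOf : ∀ (W : WeierstrassCurve ℚ) [W.IsElliptic] [W.IsGloballyMinimal] (p : ℕ) [Fact p.Prime],
  KatoDescentDatum p → Prop}
variable {KMC : ∀ (W : WeierstrassCurve ℚ) [W.IsElliptic] [W.IsGloballyMinimal] (p : ℕ), Prop}

/-- **For a realised datum: `D.Conj1210 ⟺ BSD_p`'s lower half, and the upper half holds** — the core
of everything below. From Reading 1: `#Ш_an = q'` with `ord_p q' = ord_p #Ш + m`, `[A : z] = p^m #H²`;
the tree's descent theorem turns `Conj1210` into `m = 0`, and its converse (with Reading 2) turns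
`m = 0` into `Conj1210`. [cite: Kato2004Asterisque, §14.14 (p. 243), Conj. 12.10 (p. 224), Thm. 12.5 (4) (p. 222)] -/
theorem conj1210_iff_missingLowerBoundAt_of_readings (hR : DescentCountReading IsOf)
    (hdiv : DivisibilityReading IsOf) (hGZK : rank_eq_analyticRank_of_analyticRank_le_one)
    (hmod : hasEntireLFunction_rat)
    (W : WeierstrassCurve ℚ) [W.IsElliptic] [W.IsGloballyMinimal] (p : ℕ) [Fact p.Prime]
    (D : KatoDescentDatum p) (hr : W.analyticRank = 0) (hp : p ≠ 2) (hadd : Addv W p)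
    (hj : 0 ≤ padicValRat p W.j) (hK : Kato2004.ImageContainsSL2 W p) (hDof : IsOf W p D) :
    MissingUpperBoundAt W p ∧ (D.Conj1210 ↔ MissingLowerBoundAt W p) := by
  have hL : W.entireLFunction 1 ≠ 0 := (W.analyticRank_eq_zero_iff_holds (hmod W)).mp hr
  have hfin : Finite W.sha := (hGZK W (by rw [hr]; exact zero_le_one)).2
  obtain ⟨hfinH2, q, m, hq, hidx, hcount⟩ := hR W p D hp hadd hj hK hL hfin hDof
  obtain ⟨q', hq', hv⟩ :=
    exists_shaAn_eq_of_count W p hGZK hr hL (irr_of_imageContainsSL2 W p hK) hq hcount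
  obtain ⟨hup, hlow⟩ := missingLowerBoundAt_iff_of_shaAn_eq W p hq' hv
  refine ⟨hup, ?_⟩
  rw [hlow, ← D.zetaIndex_eq_h2Card_iff hfinH2 hidx]
  exact ⟨D.zetaIndex_eq_h2Card_of_conj1210 hfinH2,
    D.conj1210_of_zetaIndex_eq_h2Card hfinH2 (hdiv W p D hp hadd hj hK hDof)⟩

/-- **KMC⁰ ⇒ BSD_p (both halves) in analytic rank `0` at an additive, potentially good `p ≠ 2` under
(12.5.2)** — over Readings 1, 3 and the interface lemma (Reading 2 is not needed in this direction).
This is the DESCENT the cell asked for ("descent KMC_p(f_E) ⇒ BSD_p at an additive potentially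
supersingular prime", rank `0`): the local index `exp*H¹(ℚ_p,T) = c_p·p^{−t}` and the `ℓ ≠ p`
Tamagawa factors are inside Reading 1 (Lemma T — C.-H. Kim's Conj. 7.4 is NOT an input), and the
`Λ`-adic descent is the tree theorem. [cite: Kato2004Asterisque, Conj. 12.10 (p. 224), §14.14 (p. 243), Prop. 14.16 (2) (p. 244)] -/
theorem missingPPartAt_of_kmc_of_readings (hR : DescentCountReading IsOf) (hreal : Realizable IsOf)
    (hread : ReadsTrivialKMC IsOf KMC) (hGZK : rank_eq_analyticRank_of_analyticRank_le_one)
    (hmod : hasEntireLFunction_rat)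
    (W : WeierstrassCurve ℚ) [W.IsElliptic] [W.IsGloballyMinimal] (p : ℕ) [Fact p.Prime]
    (hr : W.analyticRank = 0) (hp : p ≠ 2) (hadd : Addv W p) (hj : 0 ≤ padicValRat p W.j)
    (hK : Kato2004.ImageContainsSL2 W p) (hKMC : KMC W p) : MissingPPartAt W p := by
  have hL : W.entireLFunction 1 ≠ 0 := (W.analyticRank_eq_zero_iff_holds (hmod W)).mp hr
  have hfin : Finite W.sha := (hGZK W (by rw [hr]; exact zero_le_one)).2
  obtain ⟨D, hDof⟩ := hreal W p hp hadd hj hK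
  obtain ⟨hfinH2, q, m, hq, hidx, hcount⟩ := hR W p D hp hadd hj hK hL hfin hDof
  obtain ⟨q', hq', hv⟩ :=
    exists_shaAn_eq_of_count W p hGZK hr hL (irr_of_imageContainsSL2 W p hK) hq hcount
  obtain ⟨hup, hlow⟩ := missingLowerBoundAt_iff_of_shaAn_eq W p hq' hv
  have hm : m = 0 := (D.zetaIndex_eq_h2Card_iff hfinH2 hidx).mp
    (D.zetaIndex_eq_h2Card_of_conj1210 hfinH2 ((hread W p D hDof).mp hKMC))
  exact missingPPartAt_of_lower_of_upper W p (hlow.mpr hm) hup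

/-- **The converse: BSD_p's LOWER half ⇒ Kato's Conj. 12.10 on the trivial component, for every
realised datum** (Readings 1–2). So a `3`-descent / a `p ∤ #Ш_an` row / any closed census pair PROVES
`KMC⁰` for that curve (cf. `O6/MainConjectureEvenIffBSD.lean`, "the direction ⟸ is the useful one").
[cite: Kato2004Asterisque, Conj. 12.10 (p. 224), Thm. 12.5 (4) (p. 222), §14.14 (p. 243)] -/
theorem conj1210_of_missingLowerBoundAt_of_readings (hR : DescentCountReading IsOf)
    (hdiv : DivisibilityReading IsOf) (hGZK : rank_eq_analyticRank_of_analyticRank_le_one)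
    (hmod : hasEntireLFunction_rat)
    (W : WeierstrassCurve ℚ) [W.IsElliptic] [W.IsGloballyMinimal] (p : ℕ) [Fact p.Prime]
    (D : KatoDescentDatum p) (hr : W.analyticRank = 0) (hp : p ≠ 2) (hadd : Addv W p)
    (hj : 0 ≤ padicValRat p W.j) (hK : Kato2004.ImageContainsSL2 W p) (hDof : IsOf W p D)
    (hlow : MissingLowerBoundAt W p) : D.Conj1210 :=
  (conj1210_iff_missingLowerBoundAt_of_readings hR hdiv hGZK hmod W p D hr hp hadd hj hK hDof).2.mpr
    hlow

/-- **The converse in `KMC` currency** (plus the interface lemma).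
[cite: Kato2004Asterisque, Conj. 12.10 (p. 224), Thm. 12.5 (4) (p. 222)] -/
theorem kmc_of_missingLowerBoundAt_of_readings (hR : DescentCountReading IsOf)
    (hdiv : DivisibilityReading IsOf) (hreal : Realizable IsOf) (hread : ReadsTrivialKMC IsOf KMC)
    (hGZK : rank_eq_analyticRank_of_analyticRank_le_one) (hmod : hasEntireLFunction_rat)
    (W : WeierstrassCurve ℚ) [W.IsElliptic] [W.IsGloballyMinimal] (p : ℕ) [Fact p.Prime]
    (hr : W.analyticRank = 0) (hp : p ≠ 2) (hadd : Addv W p) (hj : 0 ≤ padicValRat p W.j)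
    (hK : Kato2004.ImageContainsSL2 W p) (hlow : MissingLowerBoundAt W p) : KMC W p := by
  obtain ⟨D, hDof⟩ := hreal W p hp hadd hj hK
  exact (hread W p D hDof).mpr
    (conj1210_of_missingLowerBoundAt_of_readings hR hdiv hGZK hmod W p D hr hp hadd hj hK hDof hlow)

/-- **PROPOSITION M at every additive potentially good `p ≠ 2`: `KMC⁰(W,p) ⟺ BSD_p`'s lower half
(⟺ BSD_p, the upper half being Kato's theorem)**, in analytic rank `0` under (12.5.2) — over the
readings; NO hypothesis on `c_ℓ`, `ℓ ≠ p`, on `c_p`, or on `W(ℚ_p)[p]` (the `t` and the Tamagawa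
factors cancel / are exact). [cite: Kato2004Asterisque, Conj. 12.10 (p. 224), Thm. 12.5 (4) (p. 222), §14.14 (p. 243), Prop. 14.16 (2) (p. 244)] -/
theorem kmc_iff_missingLowerBoundAt_of_readings (hR : DescentCountReading IsOf)
    (hdiv : DivisibilityReading IsOf) (hreal : Realizable IsOf) (hread : ReadsTrivialKMC IsOf KMC)
    (hGZK : rank_eq_analyticRank_of_analyticRank_le_one) (hmod : hasEntireLFunction_rat)
    (W : WeierstrassCurve ℚ) [W.IsElliptic] [W.IsGloballyMinimal] (p : ℕ) [Fact p.Prime]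
    (hr : W.analyticRank = 0) (hp : p ≠ 2) (hadd : Addv W p) (hj : 0 ≤ padicValRat p W.j)
    (hK : Kato2004.ImageContainsSL2 W p) :
    (KMC W p ↔ MissingLowerBoundAt W p) ∧ (KMC W p ↔ MissingPPartAt W p) := by
  refine ⟨⟨fun h ↦ (lower_and_upper_of_missingPPartAt W p
      (missingPPartAt_of_kmc_of_readings hR hreal hread hGZK hmod W p hr hp hadd hj hK h)).1,
    kmc_of_missingLowerBoundAt_of_readings hR hdiv hreal hread hGZK hmod W p hr hp hadd hj hK⟩,
    ⟨missingPPartAt_of_kmc_of_readings hR hreal hread hGZK hmod W p hr hp hadd hj hK, fun h ↦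
      kmc_of_missingLowerBoundAt_of_readings hR hdiv hreal hread hGZK hmod W p hr hp hadd hj hK
        (lower_and_upper_of_missingPPartAt W p h).1⟩⟩

end Descent

/-! ## §5 The class shells: T-O6-A (A0), the O5 ∪ O6 shell, the uniform potentially-good shell -/

section Shells

variable {IsOf : ∀ (W : WeierstrassCurve ℚ) [W.IsElliptic] [W.IsGloballyMinimal] (p : ℕ) [Fact p.Prime],
  KatoDescentDatum p → Prop}
variable {KMC : ∀ (W : WeierstrassCurve ℚ) [W.IsElliptic] [W.IsGloballyMinimal] (p : ℕ), Prop}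

/-- **T-O6-A (A0) `O6.LowerHalfRankZeroOfKMC KMC` FOLLOWS from the readings** (X4 ∧ wild `3` ∧
`r_an = 0` ∧ (12.5.2): `KMC₃ ⇒ ord₃ #Ш_an ≤ ord₃ #Ш`; wild additive `3` is potentially good,
`ClassO6.padicValRat_j_nonneg`). The O6 lane's slot-1 target is thereby REDUCED to `KMC⁰` + three
printed readings; nothing is credited (every input is a hypothesis).
[cite: Kato2004Asterisque, Conj. 12.10 (p. 224), §14.14 (p. 243)] -/
theorem lowerHalfRankZeroOfKMC_of_readings (hR : DescentCountReading IsOf) (hreal : Realizable IsOf)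
    (hread : ReadsTrivialKMC IsOf KMC) (hGZK : rank_eq_analyticRank_of_analyticRank_le_one)
    (hmod : hasEntireLFunction_rat) : O6.LowerHalfRankZeroOfKMC KMC := by
  intro W _ _ hr hX hW hK hKMC
  have hO : ClassO6 W 3 := ⟨hX.1, hX.2.1, hW⟩
  exact (lower_and_upper_of_missingPPartAt W 3 (missingPPartAt_of_kmc_of_readings hR hreal hread
    hGZK hmod W 3 hr hX.1 hX.2.1 hO.padicValRat_j_nonneg hK hKMC)).1

/-- **The shared O5 ∪ O6 shell `O5.PotSupersingularLowerHalfRankZeroOfKMC KMC` FOLLOWS from the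
readings** (its binders carry `L(E,1) ≠ 0`, i.e. `r_an = 0` by `analyticRank_eq_zero_iff`).
[cite: Kato2004Asterisque, Conj. 12.10 (p. 224), §14.14 (p. 243)] -/
theorem potSupersingularLowerHalfRankZeroOfKMC_of_readings (hR : DescentCountReading IsOf)
    (hreal : Realizable IsOf) (hread : ReadsTrivialKMC IsOf KMC)
    (hGZK : rank_eq_analyticRank_of_analyticRank_le_one) (hmod : hasEntireLFunction_rat) :
    O5.PotSupersingularLowerHalfRankZeroOfKMC KMC := by
  intro W _ _ hO hK hKMC hL _
  have hr : W.analyticRank = 0 := (W.analyticRank_eq_zero_iff_holds (hmod W)).mpr hL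
  rcases hO with h | h
  · exact (lower_and_upper_of_missingPPartAt W 3 (missingPPartAt_of_kmc_of_readings hR hreal hread
      hGZK hmod W 3 hr h.1 h.2.1 h.padicValRat_j_nonneg hK hKMC)).1
  · exact (lower_and_upper_of_missingPPartAt W 3 (missingPPartAt_of_kmc_of_readings hR hreal hread
      hGZK hmod W 3 hr h.1 h.2.1 h.padicValRat_j_nonneg hK hKMC)).1

/-- **The uniform shell `PotGoodLowerHalfRankZero`, GRANTED `KMC⁰` and (12.5.2) on its rows** (cells
(G-ord), `(G) ∧ ss`, (t′), (w) alike, every odd additive potentially good `p`): the readings reduce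
it to `KMC⁰`. [cite: Kato2004Asterisque, Conj. 12.10 (p. 224), §14.14 (p. 243)] -/
theorem missingLowerBoundAt_potGood_of_kmc_of_readings (hR : DescentCountReading IsOf)
    (hreal : Realizable IsOf) (hread : ReadsTrivialKMC IsOf KMC)
    (hGZK : rank_eq_analyticRank_of_analyticRank_le_one) (hmod : hasEntireLFunction_rat)
    (W : WeierstrassCurve ℚ) [W.IsElliptic] [W.IsGloballyMinimal] (p : ℕ) [Fact p.Prime]
    (hr : W.analyticRank = 0) (hp : p ≠ 2) (hadd : Addv W p) (hj : 0 ≤ padicValRat p W.j)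
    (hK : Kato2004.ImageContainsSL2 W p) (hKMC : KMC W p) : MissingLowerBoundAt W p :=
  (lower_and_upper_of_missingPPartAt W p
    (missingPPartAt_of_kmc_of_readings hR hreal hread hGZK hmod W p hr hp hadd hj hK hKMC)).1

/-- **`BSD(E,p)` itself from `KMC⁰` over the readings** (Miller's `BSDp`, via the tree's
`bsdp_of_missingPPartAt`). [cite: Kato2004Asterisque, Conj. 12.10 (p. 224)] [cite: Miller2011LMS, Def. 1.1] -/
theorem bsdp_of_kmc_of_readings (hR : DescentCountReading IsOf) (hreal : Realizable IsOf)
    (hread : ReadsTrivialKMC IsOf KMC) (hGZK : rank_eq_analyticRank_of_analyticRank_le_one)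
    (hmod : hasEntireLFunction_rat)
    (W : WeierstrassCurve ℚ) [W.IsElliptic] [W.IsGloballyMinimal] (p : ℕ) [Fact p.Prime]
    (hr : W.analyticRank = 0) (hp : p ≠ 2) (hadd : Addv W p) (hj : 0 ≤ padicValRat p W.j)
    (hK : Kato2004.ImageContainsSL2 W p) (hKMC : KMC W p) : BSDp W p :=
  bsdp_of_missingPPartAt W p hGZK (by rw [hr]; exact zero_le_one)
    (missingPPartAt_of_kmc_of_readings hR hreal hread hGZK hmod W p hr hp hadd hj hK hKMC)

end Shells

end Summit.BirchSwinnertonDyer.Rank1Residual.Additive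

end
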